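import Literature.NumberTheory.Automorphic.CuspidalCohomologyGLRankOneProofs
import Literature.NumberTheory.Automorphic.CuspidalCohomologyGLRankOneCharacter
import HarnessLib

/-!
# Cuspidal eigenclasses for `GL_1 / ℚ`: the rank-one case of `cuspidalEigenclass_exists`
# (assembly)

Topic `NumberTheory/Automorphic`; proof file (theorems only: no definition, no named fact, no
instance) under the named fact
`Literature.NumberTheory.Automorphic.GLnCohomology.cuspidalEigenclass_exists`
(`CuspidalCohomologyGL`; Eichler–Shimura, Borel, Clozel as summarised in
[RaghuramShahidi2010, §2.2]).  It assembles the cohomological side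
(`GLnCohomology.exists_cuspidalEigenclass_one_of_character`, `CuspidalCohomologyGLRankOneProofs`: a
character `χ` of `GL₁(𝔸_{ℚ,f})` trivial on `K_f(N)` with `χ(γ) = γ^{λ₀}` on `GL₁(ℚ)⁺` gives a
non-zero class in `CuspidalCohomologyGL 1 N λ = H⁰_!` with `T_g x = χ(g) x`) with the automorphic
side (`CuspidalCohomologyGLRankOneCharacter`: the quasi-character `ω_π` of an automorphic
representation `π = W / W'` of `GL₁(𝔸_ℚ)`, trivial on `GL₁(ℚ)` and on `K(N)`, with
`ω_π((1, γ_f)) = γ^{λ₀}` for a representation of infinity type `cohomologicalInfinityType 1 ℚ λ^∨`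
and `ω_π(t_{v,i})` the Satake–Tamagawa eigenvalue):

* `GLnCohomology.cuspidalEigenclass_exists_rank_one` — **the named fact for `n = 1`**: for `N ≥ 1`,
  `λ = (λ₀)` and a cuspidal `π` of `GL₁(𝔸_ℚ)` of infinity type `cohomologicalInfinityType 1 ℚ λ^∨`
  with a `K(N)`-fixed vector, a non-zero `x ∈ CuspidalCohomologyGL 1 N λ` which is a simultaneous
  eigenclass of the `T_{v,i}`, `v ∤ N`, `i ≤ 1`, with the Satake–Tamagawa eigenvalues of the Satake
  parameters of `π`; `GLnCohomology.cuspidalEigenclass_exists_one` — the same with the binders of the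
  fact verbatim (`n := 1`).

This is the case `n = 1`, `b_1 = 0` of [RaghuramShahidi2010, §2.2] (algebraic Hecke characters in
`H⁰` of the ray class set; Eichler–Shimura–Harder); for `n ≥ 2` the fact remains a named fact.

## References

* A. Raghuram, F. Shahidi, *On certain period relations for cusp forms on `GL_n`*, Int. Math.
  Res. Not. IMRN 2008, Art. ID rnn077 (doi:10.1093/imrn/rnn077; arXiv:0707.1708), §2.2
  [RaghuramShahidi2010].
* S. Gelbart, *Automorphic forms on adele groups*, Ann. of Math. Stud. 83 (1975), §2.A
  [Gelbart1975].
-/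

noncomputable section

open scoped MatrixGroups Matrix Classical
open NumberField NumberField.mixedEmbedding IsDedekindDomain NormedSpace

namespace Literature.NumberTheory.Automorphic

/-! ### Assembly: the rank-one case of `cuspidalEigenclass_exists` -/

section Assembly

open GLnCohomology Literature.NumberTheory.DiophantineGeometry

/-- **`cuspidalEigenclass_exists` in rank one.**  For `N ≥ 1`, a weight `λ = (λ₀)` and a cuspidal
automorphic representation `π` of `GL₁(𝔸_ℚ)` of infinity type `cohomologicalInfinityType 1 ℚ λ^∨`
(`a`-exponent `-λ₀`) with a `K(N)`-fixed vector, there is a non-zero class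
`x ∈ CuspidalCohomologyGL 1 N λ = H⁰_!(S(K_f(N)), Ṽ_λ)` which is a simultaneous eigenclass of the
`T_{v,i}`, `v ∤ N`, `i ≤ 1`, with the Satake–Tamagawa eigenvalues of the Satake parameters of `π`.
Proof: the quasi-character `ω` of `π` (`exists_quasiCharacter_glOne`) is trivial on `K(N)` and on
`GL₁(ℚ)`, and `A_G` acts through `e^{-λ₀ log a}` (`lieDeriv_one_sub_smul_mem_of_hasInfinityType_rat`,
`rightTranslation_expMem_sub_exp_smul_mem_glOne`), so its finite part `χ = ω ∘ (1, ·)` satisfies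
`χ(γ) = γ^{λ₀}` on `GL₁(ℚ)⁺` (`rightTranslation_ofFinite_rat_sub_smul_mem`); the class of
`c ↦ χ(c) w₀` (`exists_cuspidalEigenclass_one_of_character`) is the eigenclass, and
`χ(t_{v,i})` is the Satake eigenvalue (`quasiCharacter_heckeElement_eq_of_hasSatakeParamAt`).
This is the case `n = 1` (`b_1 = 0`) of [RaghuramShahidi2010, §2.2] (Eichler–Shimura–Harder:
algebraic Hecke characters in `H⁰` of the ray class set). [cite: RaghuramShahidi2010, §2.2] -/
theorem GLnCohomology.cuspidalEigenclass_exists_rank_one (N : ℕ) (hN : 1 ≤ N)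
    (hc : isCompact_glFiniteIntegralLevel 1 ℚ) (wt : Fin 1 → ℤ)
    (π : CuspidalAutomorphicRepData 1 ℚ hc)
    (hT : π.1.HasInfinityType
      (Literature.Barriers.Langlands.cohomologicalInfinityType 1 ℚ (Weight.dual wt)))
    (hfix : ∃ φ ∈ π.1.W, φ ∉ π.1.W' ∧
      ∀ u ∈ principalCongruenceLevel 1 ℚ (Ideal.span {(N : 𝓞 ℚ)}),
        rightTranslation (AdelicGroupData.gl 1 ℚ) u φ = φ) :
    ∃ x ∈ CuspidalCohomologyGL 1 N wt, x ≠ 0 ∧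
      ∀ v : HeightOneSpectrum (𝓞 ℚ), ¬ v.asIdeal ∣ Ideal.span {(N : 𝓞 ℚ)} →
        ∀ α : Multiset ℂ, π.1.HasSatakeParamAt v α → IsSatakeEigenclassAt x v α := by
  obtain ⟨φ, hφW, hφW', hφfix⟩ := hfix
  have hN0 : Ideal.span {(N : 𝓞 ℚ)} ≠ 0 := by
    rw [Ne, Ideal.zero_eq_bot, Ideal.span_singleton_eq_bot]
    exact_mod_cast (Nat.one_le_iff_ne_zero.mp hN)
  -- the quasi-character and its finite part
  obtain ⟨ω, hω⟩ := π.1.exists_quasiCharacter_glOne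
  have hωK : ∀ u ∈ principalCongruenceLevel 1 ℚ (Ideal.span {(N : 𝓞 ℚ)}),
      ω (show (AdelicGroupData.gl 1 ℚ).Adelic from u) = 1 := by
    intro u hu
    have h := π.1.eq_of_sub_smul_mem (hω (show (AdelicGroupData.gl 1 ℚ).Adelic from u)) hφW hφW'
      (b := 1) (by rw [hφfix u hu, one_smul, sub_self]; exact π.1.W'.zero_mem)
    exact Units.val_eq_one.mp h
  let χ : BigHeckeGLn.FiniteAdelicGL 1 ℚ →* ℂˣ := ω.comp (GLn.ofFinite 1 ℚ)
  have hχ : ∀ h, χ h = ω (show (AdelicGroupData.gl 1 ℚ).Adelic from GLn.ofFinite 1 ℚ h) := fun h => rfl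
  -- (i) `χ` is trivial on `K_f(N)`
  have hL : ∀ u ∈ level 1 N, χ u = 1 := fun u hu =>
    hωK _ ((mem_finitePrincipalCongruenceLevel_iff).mp hu)
  -- (ii) `χ(γ) = γ^{λ₀}` on `GL₁(ℚ)⁺`
  have hs : ∀ ψ ∈ π.1.W, lieDeriv (AutomorphyDatum.gl 1 ℚ hc).ofArch
      (⟨1, trivial⟩ : (AutomorphyDatum.gl 1 ℚ hc).arch.lie) ψ - ((Weight.dual wt 0 : ℤ) : ℂ) • ψ ∈ π.1.W' :=
    fun ψ hψ => π.1.lieDeriv_one_sub_smul_mem_of_hasInfinityType_rat hT hψ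
  have hΓ : ∀ γ : Matrix.GLPos (Fin 1) ℚ, χ (diagPos 1 γ) =
      Matrix.GeneralLinearGroup.det (ratPointsToField ℂ 1 (γ : GL (Fin 1) ℚ)) ^ lowestEntry wt := by
    intro γ
    set q : ℚ := ((γ : GL (Fin 1) ℚ) : Matrix (Fin 1) (Fin 1) ℚ) 0 0 with hq
    have hdet : (0 : ℚ) < q := by
      have h := (Matrix.mem_glpos (γ : GL (Fin 1) ℚ)).mp γ.2
      rwa [Matrix.GeneralLinearGroup.val_det_apply, Matrix.det_fin_one] at h
    have hq0 : (0 : ℝ) < (q : ℝ) := by exact_mod_cast hdet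
    have hval : ((χ (diagPos 1 γ) : ℂˣ) : ℂ) =
        Complex.exp (-(((Weight.dual wt 0 : ℤ) : ℂ) * Real.log (q : ℝ))) :=
      π.1.eq_of_sub_smul_mem (hω _) hφW hφW' (π.1.rightTranslation_ofFinite_rat_sub_smul_mem hs γ hφW)
    refine Units.ext ?_
    rw [hval, Units.val_zpow_eq_zpow_val, Matrix.GeneralLinearGroup.val_det_apply, lowestEntry_succ]
    have hd : (((ratPointsToField ℂ 1 (γ : GL (Fin 1) ℚ) : GL (Fin 1) ℂ) : Matrix (Fin 1) (Fin 1) ℂ)).det =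
        ((q : ℝ) : ℂ) := by
      rw [Matrix.det_fin_one]
      change algebraMap ℚ ℂ q = ((q : ℝ) : ℂ)
      rw [eq_ratCast, Complex.ofReal_ratCast]
    rw [hd, show (Fin.last 0 : Fin 1) = 0 from rfl]
    change Complex.exp (-((-(wt (Fin.rev 0)) : ℤ) * (Real.log (q : ℝ) : ℂ))) = ((q : ℝ) : ℂ) ^ wt 0
    rw [show (Fin.rev 0 : Fin 1) = 0 from rfl, Int.cast_neg, neg_mul, neg_neg, ← Complex.ofReal_intCast,
      ← Complex.ofReal_mul, ← Complex.ofReal_exp, mul_comm, ← Real.rpow_def_of_pos hq0,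
      Real.rpow_intCast, Complex.ofReal_zpow]
  -- the eigenclass
  obtain ⟨x, hx, hx0, hxT⟩ := exists_cuspidalEigenclass_one_of_character N wt χ hL hΓ
  refine ⟨x, hx, hx0, fun v hv α hα i hi => ?_⟩
  change heckeOp ℂ 1 N wt (bottomDegree 1) (BigHeckeGLn.heckeElement 1 ℚ v i) x = _
  rw [hxT, hχ, π.1.quasiCharacter_heckeElement_eq_of_hasSatakeParamAt hω hN0 hωK hv hα hi]
  rfl

/-- **The named fact `cuspidalEigenclass_exists` with `n = 1`**, binders exactly as in the fact (the
dominance hypothesis is vacuous in rank one and unused). [cite: RaghuramShahidi2010, §2.2] -/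
theorem GLnCohomology.cuspidalEigenclass_exists_one :
    ∀ (N : ℕ), 1 ≤ 1 → 1 ≤ N → ∀ (hc : isCompact_glFiniteIntegralLevel 1 ℚ) (wt : Fin 1 → ℤ),
      Weight.IsDominant wt →
      ∀ π : CuspidalAutomorphicRepData 1 ℚ hc,
        π.1.HasInfinityType
            (Literature.Barriers.Langlands.cohomologicalInfinityType 1 ℚ (Weight.dual wt)) →
        (∃ φ ∈ π.1.W, φ ∉ π.1.W' ∧
          ∀ u ∈ principalCongruenceLevel 1 ℚ (Ideal.span {(N : 𝓞 ℚ)}),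
            rightTranslation (AdelicGroupData.gl 1 ℚ) u φ = φ) →
        ∃ x ∈ CuspidalCohomologyGL 1 N wt, x ≠ 0 ∧
          ∀ v : HeightOneSpectrum (𝓞 ℚ), ¬ v.asIdeal ∣ Ideal.span {(N : 𝓞 ℚ)} →
            ∀ α : Multiset ℂ, π.1.HasSatakeParamAt v α → IsSatakeEigenclassAt x v α :=
  fun N _ hN hc wt _ π hT hfix => cuspidalEigenclass_exists_rank_one N hN hc wt π hT hfix

end Assembly

end Literature.NumberTheory.Automorphic
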